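import Literature.Combinatorics.Optimization.RationalPsdRank
import Literature.Combinatorics.Optimization.PsdFactorNorms
import HarnessLib

/-!
# The compression–parity criterion for psd rank (Gouveia–Robinson–Thomas 2013, Prop. 2.6 + Lemma 2.4 + Ex. 2.3, packaged)

A matrix-generic lower-bound criterion one step BEYOND the triangular ("psd fooling set") bound, assembled from three
results already in the tree:

* GRT Prop. 2.6 compression [GouveiaRobinsonThomas2013, Prop. 2.6 (p06)] (tree: `rank_rowFactor_add_le_of_triangular`,
  `rank_colFactor_add_le_of_triangular`): a triangular `K`-pattern inside the columns where row `i` vanishes forces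
  `rank A_i + K ≤ size` for every psd factorisation; same for columns;
* GRT Lemma 2.4 = FGPRT Prop. 6.2 [FawziEtAl2015, Prop. 6.2 (p18)] (tree: `FawziEtAl2015_prop62_holds`): rank-one
  factors of size `r` give a real Hadamard square root of rank `≤ r`;
* GRT Example 2.3's parity count [GouveiaRobinsonThomas2013, Ex. 2.3 (p05): "every Hadamard square root has odd
  determinant"] (tree precedent: `PsdFactorNorms` §GrtEx23 for one `3 × 3` matrix), here for an arbitrary `k × k` minor
  on which the matrix is `c · X` with `X` a `0/1` matrix invertible over `𝔽₂` and `c > 0`: every real `N` with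
  `N ∘ N = M` has `N = √c · Z` there with `Z` an integer sign matrix `≡ X (mod 2)`, so `det Z` is odd and `rank N ≥ k`.

Main statement (`not_hasPsdFactorization_of_compression_parity`): if every row and every column of `M` has a triangular
`K`-pattern inside its zero set, and some `(K+2) × (K+2)` minor of `M` is `c · X` with `X ∈ {0,1}` invertible over
`𝔽₂` (an explicit inverse is the certificate), then `M` has NO psd factorisation of size `K + 1`. The three
instances `MatchingSlackPsdRank{Eight,Ten,Twelve}Lower.lean` (Edmonds' odd-cut slack of `K₈, K₁₀, K₁₂`: psd rank
`≥ 10, 15, 21`) are this criterion with hand-inlined proofs; this file is the reusable form (a typed successor for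
all `n` only needs the pattern and minor data). Also recorded: the two halves separately
(`factors_rank_le_one_of_patterns`, `le_rank_of_hadamardSqrt_of_oddMinor`). Everything is proved; no named fact.
-/

noncomputable section

open Finset Matrix

namespace Literature.Combinatorics.Optimization

namespace CompressionParity

variable {ι κ : Type}

/-- **Compression on every row and column** [GRT Prop. 2.6]: if each row `i` has a triangular `K`-pattern inside the
columns where it vanishes, and each column likewise, then every factor of a psd factorisation of size `K + 1` has rank
`≤ 1`. [cite: GouveiaRobinsonThomas2013, Prop. 2.6 (p06); Prop. 3.2 (p07)] -/
theorem factors_rank_le_one_of_patterns {M : ι → κ → ℝ} {K : ℕ}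
    (hrow : ∀ i, ∃ (ρ : Fin K → ι) (γ : Fin K → κ),
      (∀ a, M i (γ a) = 0) ∧ (∀ a, M (ρ a) (γ a) ≠ 0) ∧ ∀ a b, a < b → M (ρ a) (γ b) = 0)
    (hcol : ∀ j, ∃ (ρ : Fin K → ι) (γ : Fin K → κ),
      (∀ a, M (ρ a) j = 0) ∧ (∀ a, M (ρ a) (γ a) ≠ 0) ∧ ∀ a b, a < b → M (ρ a) (γ b) = 0)
    (A : ι → Matrix (Fin (K + 1)) (Fin (K + 1)) ℝ) (B : κ → Matrix (Fin (K + 1)) (Fin (K + 1)) ℝ)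
    (hA : ∀ i, (A i).PosSemidef) (hB : ∀ j, (B j).PosSemidef) (hM : ∀ i j, M i j = (A i * B j).trace) :
    (∀ i, (A i).rank ≤ 1) ∧ ∀ j, (B j).rank ≤ 1 := by
  refine ⟨fun i => ?_, fun j => ?_⟩
  · obtain ⟨ρ, γ, h0, hd, ho⟩ := hrow i
    have h := rank_rowFactor_add_le_of_triangular A B hA hB hM i ρ γ h0 hd ho
    omega
  · obtain ⟨ρ, γ, h0, hd, ho⟩ := hcol j
    have h := rank_colFactor_add_le_of_triangular A B hA hB hM j ρ γ h0 hd ho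
    omega

/-- The integer SIGN MATRIX of a real `k × k` matrix on a `0/1` pattern `X`: `±X` according to the sign of the entry.
[cite: GouveiaRobinsonThomas2013, Ex. 2.3 (p05)] -/
def signMat {k : ℕ} (X : Fin k → Fin k → ℕ) (N' : Matrix (Fin k) (Fin k) ℝ) : Matrix (Fin k) (Fin k) ℤ :=
  fun a b => if 0 ≤ N' a b then (X a b : ℤ) else -(X a b : ℤ)

/-- Modulo `2` the sign matrix is the pattern (`−1 = 1` in `𝔽₂`). [cite: GouveiaRobinsonThomas2013, Ex. 2.3 (p05)] -/
theorem signMat_map_zmod {k : ℕ} (X : Fin k → Fin k → ℕ) (hX : ∀ a b, X a b ≤ 1) (N' : Matrix (Fin k) (Fin k) ℝ) :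
    (signMat X N').map (Int.cast : ℤ → ZMod 2) = Matrix.of fun a b => (X a b : ZMod 2) := by
  ext a b
  simp only [map_apply, signMat, of_apply]
  rcases Nat.le_one_iff_eq_zero_or_eq_one.1 (hX a b) with h0 | h1
  · simp [h0]
  · rw [h1]
    split_ifs <;> decide

/-- If the `0/1` pattern is invertible over `𝔽₂` (certificate: a right inverse `Y`), the sign matrix has odd, hence
nonzero, determinant. [cite: GouveiaRobinsonThomas2013, Ex. 2.3 (p05)] -/
theorem det_signMat_ne_zero {k : ℕ} (X : Fin k → Fin k → ℕ) (hX : ∀ a b, X a b ≤ 1)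
    (Y : Matrix (Fin k) (Fin k) (ZMod 2)) (hXY : Matrix.of (fun a b => (X a b : ZMod 2)) * Y = 1)
    (N' : Matrix (Fin k) (Fin k) ℝ) : (signMat X N').det ≠ 0 := by
  set X2 : Matrix (Fin k) (Fin k) (ZMod 2) := Matrix.of fun a b => (X a b : ZMod 2) with hX2
  have hdet2 : X2.det ≠ 0 := by
    intro h
    have h1 : (X2 * Y).det = 1 := by rw [hXY, det_one]
    rw [det_mul, h, zero_mul] at h1
    exact zero_ne_one h1
  intro h0
  apply hdet2
  have hmap : (((signMat X N').det : ℤ) : ZMod 2) = ((signMat X N').map (Int.cast : ℤ → ZMod 2)).det := by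
    have := RingHom.map_det (Int.castRingHom (ZMod 2)) (signMat X N')
    simpa [RingHom.mapMatrix_apply] using this
  rw [hX2, ← signMat_map_zmod X hX N', ← hmap, h0, Int.cast_zero]

/-- **Parity of Hadamard square roots** [GRT Ex. 2.3, generalised]: if on a `k × k` minor `M = c · X` with `c > 0`,
`X ∈ {0,1}` invertible over `𝔽₂`, then every real `N` with `N ∘ N = M` has rank `≥ k` (on the minor `N = √c · Z` with
`Z` the sign matrix, `det Z` odd). [cite: GouveiaRobinsonThomas2013, Ex. 2.3 (p05)] -/
theorem le_rank_of_hadamardSqrt_of_oddMinor [Fintype ι] [Fintype κ] {M : ι → κ → ℝ} {k : ℕ}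
    (ρ : Fin k → ι) (γ : Fin k → κ) (X : Fin k → Fin k → ℕ) (hX : ∀ a b, X a b ≤ 1) (c : ℝ) (hc : 0 < c)
    (hMX : ∀ a b, M (ρ a) (γ b) = c * X a b)
    (Y : Matrix (Fin k) (Fin k) (ZMod 2)) (hXY : Matrix.of (fun a b => (X a b : ZMod 2)) * Y = 1)
    (N : Matrix ι κ ℝ) (hN : ∀ i j, N i j ^ 2 = M i j) : k ≤ N.rank := by
  set N' : Matrix (Fin k) (Fin k) ℝ := N.submatrix ρ γ with hN'
  have hsq : ∀ a b, N' a b ^ 2 = c * (X a b : ℝ) := by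
    intro a b
    rw [hN', submatrix_apply, hN, hMX]
  have hs : Real.sqrt c ^ 2 = c := Real.sq_sqrt hc.le
  have hZ : ∀ a b, N' a b = Real.sqrt c * ((signMat X N' a b : ℤ) : ℝ) := by
    intro a b
    have h2 := hsq a b
    rcases Nat.le_one_iff_eq_zero_or_eq_one.1 (hX a b) with h0 | h1
    · have hz : N' a b = 0 := by
        rw [h0, Nat.cast_zero, mul_zero] at h2
        exact (pow_eq_zero_iff (n := 2) (by norm_num)).1 h2
      simp [signMat, hz, h0]
    · rw [h1, Nat.cast_one, mul_one] at h2
      have hfac : (N' a b - Real.sqrt c) * (N' a b + Real.sqrt c) = 0 := by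
        have : (N' a b - Real.sqrt c) * (N' a b + Real.sqrt c) = N' a b ^ 2 - Real.sqrt c ^ 2 := by ring
        rw [this, hs, h2]; ring
      rcases mul_eq_zero.1 hfac with hp | hm
      · have hval : N' a b = Real.sqrt c := by linarith
        have hnn : 0 ≤ N' a b := by rw [hval]; exact Real.sqrt_nonneg c
        have hZ1 : signMat X N' a b = 1 := by simp [signMat, hnn, h1]
        rw [hZ1, hval]; push_cast; ring
      · have hval : N' a b = -Real.sqrt c := by linarith
        have hneg : ¬ 0 ≤ N' a b := by
          rw [hval, not_le, neg_lt_zero]; exact Real.sqrt_pos.2 hc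
        have hZm : signMat X N' a b = -1 := by simp [signMat, hneg, h1]
        rw [hZm, hval]; push_cast; ring
  have hN'eq : N' = Real.sqrt c • ((signMat X N').map (Int.cast : ℤ → ℝ)) := by
    ext a b
    rw [Matrix.smul_apply, map_apply, smul_eq_mul, hZ]
  have hdetN' : N'.det ≠ 0 := by
    rw [hN'eq, det_smul, Fintype.card_fin]
    have hmap : ((signMat X N').map (Int.cast : ℤ → ℝ)).det = (((signMat X N').det : ℤ) : ℝ) := by
      have := RingHom.map_det (Int.castRingHom ℝ) (signMat X N')
      simpa [RingHom.mapMatrix_apply] using this.symm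
    rw [hmap]
    refine mul_ne_zero (pow_ne_zero _ (Real.sqrt_ne_zero'.2 hc)) ?_
    exact_mod_cast det_signMat_ne_zero X hX Y hXY N'
  have hrank : N'.rank = k := by
    simpa using rank_of_isUnit N' ((isUnit_iff_isUnit_det _).2 (isUnit_iff_ne_zero.2 hdetN'))
  calc k = N'.rank := hrank.symm
    _ ≤ N.rank := by rw [hN']; exact rank_submatrix_le N ρ γ

end CompressionParity

open CompressionParity

/-- **The compression–parity criterion.** Let `M` be a real matrix on finite index types. Suppose (i) every row `i`
has a triangular `K`-pattern inside the columns where it vanishes and every column `j` one inside the rows where it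
vanishes, and (ii) on some `k × k` minor `M = c · X` with `c > 0`, `X ∈ {0,1}` invertible over `𝔽₂` (certificate
`X · Y = 1`), with `K + 1 < k`. Then `M` has NO psd factorisation of size `K + 1` — one more than what the fooling-set
bound gives when `K + 1` is the largest triangular pattern. (Compression ⇒ rank-one factors ⇒ Hadamard square root
of rank `≤ K + 1` ⇒ contradicts (ii).)
[cite: GouveiaRobinsonThomas2013, Prop. 2.6 + Lemma 2.4 + Ex. 2.3 (p05–p07); FawziEtAl2015, Prop. 6.2 (p18)] -/
theorem not_hasPsdFactorization_of_compression_parity {ι κ : Type} [Fintype ι] [Fintype κ] {M : ι → κ → ℝ} {K k : ℕ}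
    (hrow : ∀ i, ∃ (ρ : Fin K → ι) (γ : Fin K → κ),
      (∀ a, M i (γ a) = 0) ∧ (∀ a, M (ρ a) (γ a) ≠ 0) ∧ ∀ a b, a < b → M (ρ a) (γ b) = 0)
    (hcol : ∀ j, ∃ (ρ : Fin K → ι) (γ : Fin K → κ),
      (∀ a, M (ρ a) j = 0) ∧ (∀ a, M (ρ a) (γ a) ≠ 0) ∧ ∀ a b, a < b → M (ρ a) (γ b) = 0)
    (ρm : Fin k → ι) (γm : Fin k → κ) (X : Fin k → Fin k → ℕ) (hX : ∀ a b, X a b ≤ 1) (c : ℝ) (hc : 0 < c)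
    (hMX : ∀ a b, M (ρm a) (γm b) = c * X a b)
    (Y : Matrix (Fin k) (Fin k) (ZMod 2)) (hXY : Matrix.of (fun a b => (X a b : ZMod 2)) * Y = 1)
    (hKk : K + 1 < k) : ¬ HasPsdFactorization M (K + 1) := by
  rintro ⟨A, B, hA, hB, hM⟩
  obtain ⟨hAr, hBr⟩ := factors_rank_le_one_of_patterns hrow hcol A B hA hB hM
  obtain ⟨N, hN, hr⟩ := FawziEtAl2015_prop62_holds ι κ M (K + 1)
    ⟨A, B, fun i => ⟨hA i, hAr i⟩, fun j => ⟨hB j, hBr j⟩, hM⟩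
  have := le_rank_of_hadamardSqrt_of_oddMinor ρm γm X hX c hc hMX Y hXY N hN
  omega

/-- Monotone form: under the hypotheses of `not_hasPsdFactorization_of_compression_parity`, every psd factorisation of
`M` has size `≥ K + 2`. [cite: GouveiaRobinsonThomas2013, Prop. 2.6 + Lemma 2.4 + Ex. 2.3 (p05–p07)] -/
theorem le_of_hasPsdFactorization_of_compression_parity {ι κ : Type} [Fintype ι] [Fintype κ] {M : ι → κ → ℝ} {K k : ℕ}
    (hrow : ∀ i, ∃ (ρ : Fin K → ι) (γ : Fin K → κ),
      (∀ a, M i (γ a) = 0) ∧ (∀ a, M (ρ a) (γ a) ≠ 0) ∧ ∀ a b, a < b → M (ρ a) (γ b) = 0)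
    (hcol : ∀ j, ∃ (ρ : Fin K → ι) (γ : Fin K → κ),
      (∀ a, M (ρ a) j = 0) ∧ (∀ a, M (ρ a) (γ a) ≠ 0) ∧ ∀ a b, a < b → M (ρ a) (γ b) = 0)
    (ρm : Fin k → ι) (γm : Fin k → κ) (X : Fin k → Fin k → ℕ) (hX : ∀ a b, X a b ≤ 1) (c : ℝ) (hc : 0 < c)
    (hMX : ∀ a b, M (ρm a) (γm b) = c * X a b)
    (Y : Matrix (Fin k) (Fin k) (ZMod 2)) (hXY : Matrix.of (fun a b => (X a b : ZMod 2)) * Y = 1)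
    (hKk : K + 1 < k) {r : ℕ} (h : HasPsdFactorization M r) : K + 2 ≤ r := by
  by_contra hlt
  exact not_hasPsdFactorization_of_compression_parity hrow hcol ρm γm X hX c hc hMX Y hXY hKk (h.mono (by omega))

end Literature.Combinatorics.Optimization
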